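import Summits.CriticalPhenomena.PercolationContinuityZ3.Theorems.PercNearOneGluingNoHeavyQuantThreePortTransfer
import Summits.CriticalPhenomena.PercolationContinuityZ3.Theorems.PercNearOneGluingNoHeavyQuantFarProfileRows
import HarnessLib

/-!
# `Z(3,2)` on graphs with at most four vertices, part 1: the triangle off the observer (reachability, cells) and the residual inequality

builds on p205010 (kernel theorem, internal audit signed; external expert review pending)

Support file (`--supports stmt-CriticalPhenomena-4575`), seat `prim-quant-p1` (gen 3); memo `run/shared/lean/prim/quant/P1-SURPLUS.md` §13.8–13.10.
No definitions, no named facts, no sorries; standard axioms.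

`OneCutFive.ZeroOneThree` (open): for an observer `o` and three relays `a, b, c` with `Σ_v μ(o↔v) > 2` and `t ≥ μ(o↮v)` (all `v`):
`μ{o reaches at most one of a,b,c} ≤ t`.  In part 2 (`…QuantZeroOneK4`) it is PROVED whenever `o, a, b, c` exhaust the vertex set (`∀ u, u = o ∨ u = a ∨ u = b ∨ u = c`),
i.e. for `K4` with six arbitrary weights (`ThreePort.le_one_reached_le_K4`), and hence in `ZeroOneThree`'s own shape for every `n ≤ 4`
(`ThreePort.zeroOneThree_of_card_le_four`) — the first complete graph class containing a second-order-tight family (`W4`, memo §12.1).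

PROOF (memo §13.10; hairs `α, β, γ` at `o`, triangle `x = w(ab)`, `y = w(ac)`, `z = w(bc)`, bars for `1 − ·`).  The three-point cells of the
triangle off `o` are cylinders: `U0 = x̄ȳz̄`, `μ{b~c, ¬a~b} = z x̄ȳ` etc. (`real_allApart_K4`, `real_pairOnly_K4`).  If the pocket exchange
`μ(B={v}) ≤ μ(B = the other two)` held at SOME apex `v` we would be done (`measureReal_le_one_le_compl_of_exchange`).  If it fails at all
three apexes, `ThreePort.margin_eq` at each apex gives  `z·c_z < T⁻`, `y·c_y < W_b`, `x·c_x < W_c`  with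
`c_z = ᾱ(β+γ−2βγ)`, `c_y = β̄(α+γ−2αγ)`, `c_x = γ̄(α+β−2αβ)`, `T⁻ = αβ̄γ̄ − ᾱβγ`, `W_b = ᾱβγ̄ − αβ̄γ`, `W_c = ᾱγβ̄ − αγ̄β`;
in particular all hairs are `< ½` (`T⁻ + W_c = (1−2β)·(αγ̄+ᾱγ)` etc.).  First-moment counting (`Quant.sum_conn_le_layer_split`) gives
`Σ ≤ 3 − 3μ(N=0) − 2μ(N=1)` with `μ(N=0) ≥ ᾱβ̄γ̄` and `μ(N=1) ≥ αβ̄γ̄x̄ȳ + ᾱβγ̄x̄z̄ + ᾱβ̄γȳz̄`; using `x̄ȳ ≥ 1−x−y` and the three caps,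
`3μ(N=0) + 2μ(N=1) ≥ 1 + (1−2α)(1−2β)(1−2γ) + ᾱβ̄γ̄ > 1`, i.e. `Σ < 2` — contradicting `Σ > 2`.
[cite: KozmaNitzan2024, Lemma 2 (p. 6)] (context: level 1 of the family); the statement `Z(3,2)` itself is this programme's.
-/

noncomputable section

namespace Summit.CriticalPhenomena.PercolationContinuityZ3.Theorems

open MeasureTheory Set Literature.Probability.LatticeModels Literature.Probability.Percolation
open scoped Classical BigOperators

variable {n : ℕ}

namespace ThreePort


/-! ### Two elementary reachability facts -/

/-- An isolated vertex reaches only itself. [folklore] -/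
theorem not_reachable_of_isolated {V : Type*} (G : SimpleGraph V) (u v : V) (hiso : ∀ x, ¬ G.Adj u x) (huv : u ≠ v) :
    ¬ G.Reachable u v := by
  rintro ⟨p⟩
  cases p with
  | nil => exact huv rfl
  | cons h _ => exact hiso _ h

/-! ### The triangle off the observer: reachability and the two cell shapes (vertices `o, u, v, t` exhaust the graph) -/

/-- Adjacency off `o`. [folklore] -/
theorem adj_off_iff (o : Fin n) (ω : BondConfig (Fin n)) (p q : Fin n) :
    (openGraph (ω ∩ {e | o ∉ e})).Adj p q ↔ s(p, q) ∈ ω ∧ o ∉ s(p, q) ∧ p ≠ q := by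
  rw [openGraph_adj]; simp only [Set.mem_inter_iff, Set.mem_setOf_eq]; tauto

section Triangle

variable (o u v t : Fin n) (huo : u ≠ o) (hvo : v ≠ o) (hto : t ≠ o)
  (huv : u ≠ v) (hut : u ≠ t) (hvt : v ≠ t) (hall : ∀ y : Fin n, y = o ∨ y = u ∨ y = v ∨ y = t)
include huo hvo hto huv hut hvt hall

/-- On `{o,u,v,t}`, `u` and `v` are joined off `o` iff `uv` is open or both `ut, vt` are open. [folklore] -/
theorem reachable_off_iff (ω : BondConfig (Fin n)) :
    (openGraph (ω ∩ {e | o ∉ e})).Reachable u v ↔ s(u, v) ∈ ω ∨ (s(u, t) ∈ ω ∧ s(v, t) ∈ ω) := by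
  set G := openGraph (ω ∩ {e | o ∉ e}) with hG
  have hadj : ∀ p q : Fin n, G.Adj p q ↔ s(p, q) ∈ ω ∧ o ∉ s(p, q) ∧ p ≠ q :=
    fun p q => adj_off_iff o ω p q
  constructor
  · intro h
    by_contra hne
    push Not at hne
    obtain ⟨h1, h2⟩ := hne
    by_cases hut' : s(u, t) ∈ ω
    · -- `vt` closed: `v` is isolated
      have hvt' : s(v, t) ∉ ω := h2 hut'
      have hiso : ∀ y, ¬ G.Adj v y := by
        intro y hy
        rw [hadj] at hy
        obtain ⟨hmem, hoy, hvy⟩ := hy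
        rcases hall y with rfl | rfl | rfl | rfl
        · exact hoy (Sym2.mem_mk_right _ _)
        · exact h1 (by rw [Sym2.eq_swap]; exact hmem)
        · exact hvy rfl
        · exact hvt' hmem
      exact not_reachable_of_isolated G v u hiso (Ne.symm huv) h.symm
    · -- `ut` closed: `u` is isolated
      have hiso : ∀ y, ¬ G.Adj u y := by
        intro y hy
        rw [hadj] at hy
        obtain ⟨hmem, hoy, huy⟩ := hy
        rcases hall y with rfl | rfl | rfl | rfl
        · exact hoy (Sym2.mem_mk_right _ _)
        · exact huy rfl
        · exact h1 hmem
        · exact hut' hmem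
      exact not_reachable_of_isolated G u v hiso huv h
  · rintro (h | ⟨h1, h2⟩)
    · have : G.Adj u v := by
        rw [hadj]; exact ⟨h, by rw [Sym2.mem_iff]; push Not; exact ⟨huo.symm, hvo.symm⟩, huv⟩
      exact this.reachable
    · have h1' : G.Adj u t := by
        rw [hadj]; exact ⟨h1, by rw [Sym2.mem_iff]; push Not; exact ⟨huo.symm, hto.symm⟩, hut⟩
      have h2' : G.Adj t v := by
        rw [hadj]; refine ⟨by rw [Sym2.eq_swap]; exact h2, by rw [Sym2.mem_iff]; push Not; exact ⟨hto.symm, hvo.symm⟩, hvt.symm⟩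
      exact h1'.reachable.trans h2'.reachable

end Triangle

/-! ### The residual real inequality -/

/-- **The residual is empty (pure real algebra).**  If all three pocket exchanges fail on `K4` — in closed form `(1−z)T_a + zV_a < 0`,
`(1−y)T_b + yV_b < 0`, `(1−x)T_c + xV_c < 0` — then `3ᾱβ̄γ̄ + 2(αβ̄γ̄x̄ȳ + ᾱβγ̄x̄z̄ + ᾱβ̄γȳz̄) ≥ 1` (so `Σ ≤ 2` by counting).
Key identities: the failures read `z·c_z < T⁻`, `y·c_y < W_b`, `x·c_x < W_c`; `T⁻ + W_c = (1−2β)(αγ̄+ᾱγ)` etc. force all hairs `< ½`;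
and `3ᾱβ̄γ̄ + 2(αβ̄γ̄ + ᾱβγ̄ + ᾱβ̄γ) − 2(W_c + W_b + T⁻) = 1 + (1−2α)(1−2β)(1−2γ) + ᾱβ̄γ̄`. [this work] -/
theorem k4_residual_false (α β γ x y z : ℝ) (hα0 : 0 ≤ α) (hα1 : α ≤ 1) (hβ0 : 0 ≤ β) (hβ1 : β ≤ 1)
    (hγ0 : 0 ≤ γ) (hγ1 : γ ≤ 1) (hx0 : 0 ≤ x) (hy0 : 0 ≤ y) (hz0 : 0 ≤ z)
    (ga : (1 - z) * ((1 - α) * β * γ - α * (1 - β) * (1 - γ)) + z * (β + γ - β * γ - α) < 0)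
    (gb : (1 - y) * ((1 - β) * α * γ - β * (1 - α) * (1 - γ)) + y * (α + γ - α * γ - β) < 0)
    (gc : (1 - x) * ((1 - γ) * α * β - γ * (1 - α) * (1 - β)) + x * (α + β - α * β - γ) < 0)
    (hF : 3 * ((1 - α) * (1 - β) * (1 - γ)) + 2 * (α * (1 - β) * (1 - γ) * ((1 - x) * (1 - y)) +
      (1 - α) * β * (1 - γ) * ((1 - x) * (1 - z)) + (1 - α) * (1 - β) * γ * ((1 - y) * (1 - z))) < 1) : False := by
  -- names for the recurring polynomials
  set Tm := α * (1 - β) * (1 - γ) - (1 - α) * β * γ with hTm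
  set Wb := (1 - α) * β * (1 - γ) - α * (1 - β) * γ with hWb
  set Wc := (1 - α) * γ * (1 - β) - α * (1 - γ) * β with hWc
  set cz := (1 - α) * (β + γ - 2 * β * γ) with hcz
  set cy := (1 - β) * (α + γ - 2 * α * γ) with hcy
  set cx := (1 - γ) * (α + β - 2 * α * β) with hcx
  -- the three failed exchanges in 'cap' form (pure rearrangements)
  have ea : (1 - z) * ((1 - α) * β * γ - α * (1 - β) * (1 - γ)) + z * (β + γ - β * γ - α) = z * cz - Tm := by
    rw [hcz, hTm]; ring
  have eb : (1 - y) * ((1 - β) * α * γ - β * (1 - α) * (1 - γ)) + y * (α + γ - α * γ - β) = y * cy - Wb := by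
    rw [hcy, hWb]; ring
  have ec : (1 - x) * ((1 - γ) * α * β - γ * (1 - α) * (1 - β)) + x * (α + β - α * β - γ) = x * cx - Wc := by
    rw [hcx, hWc]; ring
  have ga' : z * cz < Tm := by linarith [ea]
  have gb' : y * cy < Wb := by linarith [eb]
  have gc' : x * cx < Wc := by linarith [ec]
  -- nonnegativity of the c's
  have hK1 : 0 ≤ α * (1 - γ) + (1 - α) * γ := by
    have := mul_nonneg hα0 (sub_nonneg.2 hγ1); have := mul_nonneg (sub_nonneg.2 hα1) hγ0; linarith
  have hK2 : 0 ≤ α * (1 - β) + (1 - α) * β := by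
    have := mul_nonneg hα0 (sub_nonneg.2 hβ1); have := mul_nonneg (sub_nonneg.2 hα1) hβ0; linarith
  have hK3 : 0 ≤ β * (1 - γ) + (1 - β) * γ := by
    have := mul_nonneg hβ0 (sub_nonneg.2 hγ1); have := mul_nonneg (sub_nonneg.2 hβ1) hγ0; linarith
  have hcz0 : 0 ≤ cz := by
    rw [hcz]; have : β + γ - 2 * β * γ = β * (1 - γ) + (1 - β) * γ := by ring
    rw [this]; exact mul_nonneg (sub_nonneg.2 hα1) hK3
  have hcy0 : 0 ≤ cy := by
    rw [hcy]; have : α + γ - 2 * α * γ = α * (1 - γ) + (1 - α) * γ := by ring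
    rw [this]; exact mul_nonneg (sub_nonneg.2 hβ1) hK1
  have hcx0 : 0 ≤ cx := by
    rw [hcx]; have : α + β - 2 * α * β = α * (1 - β) + (1 - α) * β := by ring
    rw [this]; exact mul_nonneg (sub_nonneg.2 hγ1) hK2
  -- positivity of Tm, Wb, Wc
  have hT : 0 < Tm := lt_of_le_of_lt (mul_nonneg hz0 hcz0) ga'
  have hWb0 : 0 < Wb := lt_of_le_of_lt (mul_nonneg hy0 hcy0) gb'
  have hWc0 : 0 < Wc := lt_of_le_of_lt (mul_nonneg hx0 hcx0) gc'
  -- all hairs below 1/2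
  have e1 : Tm + Wc = (1 - 2 * β) * (α * (1 - γ) + (1 - α) * γ) := by rw [hTm, hWc]; ring
  have e2 : Tm + Wb = (1 - 2 * γ) * (α * (1 - β) + (1 - α) * β) := by rw [hTm, hWb]; ring
  have e3 : Wb + Wc = (1 - 2 * α) * (β * (1 - γ) + (1 - β) * γ) := by rw [hWb, hWc]; ring
  have hβh : 0 < 1 - 2 * β := by
    by_contra h
    have h' : 1 - 2 * β ≤ 0 := by linarith
    have : (1 - 2 * β) * (α * (1 - γ) + (1 - α) * γ) ≤ 0 := mul_nonpos_of_nonpos_of_nonneg h' hK1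
    linarith
  have hγh : 0 < 1 - 2 * γ := by
    by_contra h
    have h' : 1 - 2 * γ ≤ 0 := by linarith
    have : (1 - 2 * γ) * (α * (1 - β) + (1 - α) * β) ≤ 0 := mul_nonpos_of_nonpos_of_nonneg h' hK2
    linarith
  have hαh : 0 < 1 - 2 * α := by
    by_contra h
    have h' : 1 - 2 * α ≤ 0 := by linarith
    have : (1 - 2 * α) * (β * (1 - γ) + (1 - β) * γ) ≤ 0 := mul_nonpos_of_nonpos_of_nonneg h' hK3
    linarith
  -- F ≥ G0 − 2(x cx + y cy + z cz) and G0 − 2(Wc + Wb + Tm) = 1 + (1−2α)(1−2β)(1−2γ) + ᾱβ̄γ̄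
  have eF : 3 * ((1 - α) * (1 - β) * (1 - γ)) + 2 * (α * (1 - β) * (1 - γ) * ((1 - x) * (1 - y)) +
      (1 - α) * β * (1 - γ) * ((1 - x) * (1 - z)) + (1 - α) * (1 - β) * γ * ((1 - y) * (1 - z))) =
      (1 + (1 - 2 * α) * (1 - 2 * β) * (1 - 2 * γ) + (1 - α) * (1 - β) * (1 - γ))
        + 2 * ((Wc - x * cx) + (Wb - y * cy) + (Tm - z * cz))
        + 2 * (α * (1 - β) * (1 - γ) * (x * y) + (1 - α) * β * (1 - γ) * (x * z) + (1 - α) * (1 - β) * γ * (y * z)) := by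
    rw [hTm, hWb, hWc, hcx, hcy, hcz]; ring
  have p1 : 0 ≤ α * (1 - β) * (1 - γ) * (x * y) :=
    mul_nonneg (mul_nonneg (mul_nonneg hα0 (sub_nonneg.2 hβ1)) (sub_nonneg.2 hγ1)) (mul_nonneg hx0 hy0)
  have p2 : 0 ≤ (1 - α) * β * (1 - γ) * (x * z) :=
    mul_nonneg (mul_nonneg (mul_nonneg (sub_nonneg.2 hα1) hβ0) (sub_nonneg.2 hγ1)) (mul_nonneg hx0 hz0)
  have p3 : 0 ≤ (1 - α) * (1 - β) * γ * (y * z) :=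
    mul_nonneg (mul_nonneg (mul_nonneg (sub_nonneg.2 hα1) (sub_nonneg.2 hβ1)) hγ0) (mul_nonneg hy0 hz0)
  have hprod : 0 ≤ (1 - 2 * α) * (1 - 2 * β) * (1 - 2 * γ) :=
    mul_nonneg (mul_nonneg hαh.le hβh.le) hγh.le
  have hrest : 0 ≤ (1 - α) * (1 - β) * (1 - γ) := mul_nonneg (mul_nonneg (by linarith) (by linarith)) (by linarith)
  linarith [eF, p1, p2, p3, hprod, hrest, ga', gb', gc']

/-! ### The two cell shapes of the triangle off `o` -/

section Cells

variable (w : Sym2 (Fin n) → unitInterval) (o u v t : Fin n) (huo : u ≠ o) (hvo : v ≠ o) (hto : t ≠ o)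
  (huv : u ≠ v) (hut : u ≠ t) (hvt : v ≠ t) (hall : ∀ y : Fin n, y = o ∨ y = u ∨ y = v ∨ y = t)
include huo hvo hto huv hut hvt hall

/-- `U0` of the triangle: `μ{¬u~v, ¬u~t, ¬v~t off o} = (1 − w(uv))(1 − w(ut))(1 − w(vt))`. [this work] -/
theorem real_allApart_K4 :
    (prodBernoulli w).real {ω | ¬ (openGraph (ω ∩ {e | o ∉ e})).Reachable u v ∧
        ¬ (openGraph (ω ∩ {e | o ∉ e})).Reachable u t ∧ ¬ (openGraph (ω ∩ {e | o ∉ e})).Reachable v t} =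
      (1 - w s(u, v)) * (1 - w s(u, t)) * (1 - w s(v, t)) := by
  have hall2 : ∀ y : Fin n, y = o ∨ y = u ∨ y = t ∨ y = v := fun y => by rcases hall y with h | h | h | h <;> simp [h]
  have hall3 : ∀ y : Fin n, y = o ∨ y = v ∨ y = t ∨ y = u := fun y => by rcases hall y with h | h | h | h <;> simp [h]
  have r1 := fun ω => reachable_off_iff o u v t huo hvo hto huv hut hvt hall ω
  have r2 := fun ω => reachable_off_iff o u t v huo hto hvo hut huv hvt.symm hall2 ω
  have r3 := fun ω => reachable_off_iff o v t u hvo hto huo hvt huv.symm hut.symm hall3 ω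
  have ne1 : s(u, v) ≠ s(u, t) := fun h => hvt (Sym2.congr_right.1 h)
  have ne2 : s(u, v) ≠ s(v, t) := fun h => hut (Sym2.congr_right.1 ((Sym2.eq_swap : s(v, u) = s(u, v)).trans h))
  have ne3 : s(u, t) ≠ s(v, t) := fun h => huv (Sym2.congr_left.1 h)
  have htv : s(t, v) = s(v, t) := Sym2.eq_swap
  have hvu : s(v, u) = s(u, v) := Sym2.eq_swap
  have htu : s(t, u) = s(u, t) := Sym2.eq_swap
  set F : Finset (Sym2 (Fin n)) := {s(u, v), s(u, t), s(v, t)} with hF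
  have hset : {ω : BondConfig (Fin n) | ¬ (openGraph (ω ∩ {e | o ∉ e})).Reachable u v ∧
      ¬ (openGraph (ω ∩ {e | o ∉ e})).Reachable u t ∧ ¬ (openGraph (ω ∩ {e | o ∉ e})).Reachable v t} =
      {ω | ∀ e ∈ F, (e ∈ ω ↔ False)} := by
    ext ω
    simp only [Set.mem_setOf_eq, hF, Finset.mem_insert, Finset.mem_singleton, forall_eq_or_imp, forall_eq, iff_false]
    rw [r1 ω, r2 ω, r3 ω, htv, hvu, htu]
    tauto
  rw [hset, prodBernoulli_real_setOf_forall_iff]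
  have hn1 : s(u, v) ∉ ({s(u, t), s(v, t)} : Finset (Sym2 (Fin n))) := by simp [ne1, ne2]
  rw [hF, Finset.prod_insert hn1, Finset.prod_pair ne3]
  simp only [if_false]
  ring

/-- The pair cell `vt|u` of the triangle: `μ{v~t, ¬u~v off o} = w(vt)(1 − w(uv))(1 − w(ut))`. [this work] -/
theorem real_pairOnly_K4 :
    (prodBernoulli w).real {ω | (openGraph (ω ∩ {e | o ∉ e})).Reachable v t ∧
        ¬ (openGraph (ω ∩ {e | o ∉ e})).Reachable u v} =
      w s(v, t) * (1 - w s(u, v)) * (1 - w s(u, t)) := by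
  have hall3 : ∀ y : Fin n, y = o ∨ y = v ∨ y = t ∨ y = u := fun y => by rcases hall y with h | h | h | h <;> simp [h]
  have r1 := fun ω => reachable_off_iff o u v t huo hvo hto huv hut hvt hall ω
  have r3 := fun ω => reachable_off_iff o v t u hvo hto huo hvt huv.symm hut.symm hall3 ω
  have ne1 : s(u, v) ≠ s(u, t) := fun h => hvt (Sym2.congr_right.1 h)
  have ne2 : s(u, v) ≠ s(v, t) := fun h => hut (Sym2.congr_right.1 ((Sym2.eq_swap : s(v, u) = s(u, v)).trans h))
  have ne3 : s(u, t) ≠ s(v, t) := fun h => huv (Sym2.congr_left.1 h)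
  have hvu : s(v, u) = s(u, v) := Sym2.eq_swap
  have htu : s(t, u) = s(u, t) := Sym2.eq_swap
  set F : Finset (Sym2 (Fin n)) := {s(u, v), s(u, t), s(v, t)} with hF
  have hset : {ω : BondConfig (Fin n) | (openGraph (ω ∩ {e | o ∉ e})).Reachable v t ∧
      ¬ (openGraph (ω ∩ {e | o ∉ e})).Reachable u v} = {ω | ∀ e ∈ F, (e ∈ ω ↔ e = s(v, t))} := by
    ext ω
    simp only [Set.mem_setOf_eq, hF, Finset.mem_insert, Finset.mem_singleton, forall_eq_or_imp, forall_eq, ne2, ne3,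
      iff_false]
    rw [r1 ω, r3 ω, hvu, htu]
    tauto
  rw [hset, prodBernoulli_real_setOf_forall_iff]
  have hn1 : s(u, v) ∉ ({s(u, t), s(v, t)} : Finset (Sym2 (Fin n))) := by simp [ne1, ne2]
  rw [hF, Finset.prod_insert hn1, Finset.prod_pair ne3]
  simp only [ne2, ne3, if_false, if_true]
  ring

end Cells

end ThreePort

end Summit.CriticalPhenomena.PercolationContinuityZ3.Theorems

end
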